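import Summits.BirchSwinnertonDyer.BirchSwinnertonDyer.Theorems.ThetaPartnerAtTwoSignedMainConjectureCMTwoRankZeroPTDeepSelmerSocket
import Summits.BirchSwinnertonDyer.BirchSwinnertonDyer.Theorems.ThetaPartnerAtTwoSignedMainConjectureCMTwoRankZeroPTDeepCloseOfE
import Summits.BirchSwinnertonDyer.BirchSwinnertonDyer.Theorems.ThetaPartnerAtTwoSignedMainConjectureCMTwoRankZeroPTDeepTransfer
import HarnessLib

/-!
# Route `ThetaPartnerAtTwo` (TP2), crux K2R0P♭ `SignedMainConjectureCMTwoRankZeroOfPubOfFlat` (stmt-BirchSwinnertonDyer-26471; derived node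
# K2r0P stmt-BirchSwinnertonDyer-24945), line `rankzero` v20 (f9ac3642e50e9f8a) — the registered stub `stub_poitouTateDeepTwo` ((S_PT), habitat
# form) PROVED, by name and signature, sorry-free

Cell `bsd-wall`, lead `bsd-wall-tp2-p2` g10 with width seats w2 g4 / w3 g3 / w4 g0 / w5 g0.  Theorem only; no definition, no named fact, no
instance, no `sorry`.  It closes the FIRST of the two registered stubs of the skeleton of record; the crux item itself is NOT closed by this file
(the second stub `stub_zetaErlKSideCMTwo` — Kato's zeta-element / explicit-reciprocity package for the CM form at `2` — is a published input,
not yet typed); BSD is NOT proved by any of this.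

THE PROOF (kernel route, PT-DEEP-HALF-DESIGN-w2g4.md §2–§3 / B9-INTERFACE-g10.md), all inputs tree theorems:
* `SignedLowerOffTwo.PTDeep.poitouTateDeepTwo_of_levelwise_exists (hE)` (lead, `…PTDeepCloseOfE`): Kőnig over the double tower + Rubin B.2.3
  surjectivity + norm-compatible assembly (`…PTDeepAssembly`, Literature `Kato2004/IwasawaH1ReductionSurjectiveProofs`,
  `Kato2004/IwasawaH1TowerLimitProofs`), pairing compatibilities (C) (`…PTDeepPairingCompat`), admissibility (R)+(I) off `S_A`
  (`…PTDeepAdmissible`), the bad-inertia bound (I)_bad from CM ⇒ additive potentially good reduction (w5, `…PTDeepIntegralBad`);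
* `hE := SignedLowerOffTwo.PTDeep.levelwisePoitouTate_of_transfer (hT)` (w3 g3, `…PTDeepSelmerSocket`): Milne I Thm. 4.10 (b) at every finite
  level `ℚ_n`, module `A[2^k]`, via Shapiro (`…PTDeepCoindShapiro`, `…PTDeepSelmerTransport`, w4's `…PTDeepAdmissibleTransport` /
  `…PTDeepLocalTransport`) and the one-place canonical lift (Literature `GaloisCohomology/PoitouTateSelmerStructuresCanonicalLift`), with
  POITOU–TATE ITSELF DISCHARGED by the tree theorem `SchneiderFreeAdditiveX3.PoitouTateReduction.poitouTate_selmerStructure_duality_real_holds ℚ`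
  (cell `bsd-schneider`, door-c4/door-c5 g18);
* `hT := SignedLowerOffTwo.PTDeep.transfer_two` (w2 g4 design; re-derived and landed by w5 g2, `…PTDeepTransfer`): the layer-currency transfer (T) — a class `b ∈ H¹(Γ_n, A[2^k])` that
  is unramified off `S_A`, locally trivial at the bad odd places and at infinity, and whose localisation at `v ∣ 2` is the Kummer class of a
  signed point `Q`, kills `z(Q) mod 2^k` for every `z` vanishing on the signed Selmer group (`…PTDeepHypLayer`, `…PTDeepUnramifiedLocal`,
  `…PTDeepSignedLayerAssembly`, `…PTDeepTransferTools`).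

References: Kobayashi, *Invent. Math.* 152 (2003), Thm. 7.3 (ii), (7.17)–(7.21); Milne, *Arithmetic Duality Theorems* (2006), Ch. I,
Thm. 4.10 (b); Rubin, *Euler Systems* (2000), App. B, Prop. B.2.3, §B.3; Kato, *Astérisque* 295 (2004), §17.13.
-/

set_option autoImplicit false
set_option linter.dupNamespace false

noncomputable section

open scoped Classical

open CategoryTheory NumberField IsDedekindDomain Field WeierstrassCurve
  Literature.NumberTheory.EllipticCurves Literature.NumberTheory.EllipticCurves.Kobayashi2003
  Literature.NumberTheory.EllipticCurves.Sprung2012 Literature.NumberTheory.GaloisRepresentations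
  Literature.NumberTheory.EllipticCurves.Rank1Residual
  Literature.NumberTheory.EllipticCurves.Kato2004 Literature.NumberTheory.EllipticCurves.Kato2004.EulerSystemValues ZpExtension
  Rat.HeightOneSpectrum Summit.BirchSwinnertonDyer.Rank1Residual.Supersingular
  Summit.BirchSwinnertonDyer.BirchSwinnertonDyer.Theorems.SignedKatoOffTwo

namespace Summit.BirchSwinnertonDyer.BirchSwinnertonDyer.Cruxes.SignedMainConjectureCMTwoRankZeroOfPubOfFlat.RankZero

/-- **Registered stub `stub_poitouTateDeepTwo` of line `rankzero` v20 — (S_PT), habitat form — PROVED.**  For every place `v ∋ 2`, every CM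
class member `A/ℚ` (globally minimal, CM, analytic rank `0`, good supersingular at `2`, `a₂ = 0`), cyclotomic `κ` with topological generator
`γ`, every pinned `I = 𝐇¹(T₂A)` and every layer pairing family `pair` that IS the `T₂A`-adic local Tate pairing ((P3)): there is ONE `m` such that
every functional `z` on the local signed tower points whose Kummer values kill `res_v` of the signed Selmer group is, after multiplication by
`2^m`, the pairing against a global Iwasawa class `x ∈ I.H` on every signed layer — the DEEP half of the `Λ`-adic Poitou–Tate sequence at the
local term (Kobayashi 2003 Thm. 7.3 (ii) at `p = 2` on the CM habitat).  Proof: `poitouTateDeepTwo_of_levelwise_exists ∘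
levelwisePoitouTate_of_transfer ∘ transfer_two` (module docstring).
[cite: Kobayashi2003, Thm. 7.3 (ii) (pp. 12–13), (7.17)–(7.21)] [cite: MilneADT2006, Ch. I, Thm. 4.10 (b)] [cite: Rubin2000, App. B Prop. B.2.3, §B.3]
[cite: Kato2004Asterisque, §17.13 (p. 280)] -/
theorem stub_poitouTateDeepTwo :
    ∀ (v : HeightOneSpectrum (𝓞 ℚ)), ((2 : ℕ) : 𝓞 ℚ) ∈ v.asIdeal →
      ∀ (A : WeierstrassCurve ℚ) [A.IsElliptic] [A.IsGloballyMinimal],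
        A.HasCM → A.analyticRank = 0 → GoodSS A 2 → A.frobeniusTrace 2 = 0 →
        ∀ (κ : ZpExtension ℚ 2) (γ : Field.absoluteGaloisGroup ℚ),
          κ.IsCyclotomic → κ.IsTopGenerator γ →
        ∀ [ContinuousSMul ℤ_[2] (A.tateModule 2)] (I : Kato2004.IwasawaH1Data A 2 κ γ)
          (pair : ∀ n : ℕ, H1 (tateRep A 2) (κ.layerSubgroup n) →ₗ[ℤ_[2]]
            (localLayerPointsOfEmb κ (closureEmb (K := ℚ) (v.adicCompletion ℚ)) A n →+ ℤ_[2])),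
          (∀ (n k : ℕ) (x : H1 (tateRep A 2) (κ.layerSubgroup n))
            (Q : localLayerPointsOfEmb κ (closureEmb (K := ℚ) (v.adicCompletion ℚ)) A n),
            PadicInt.toZModPow k (pair n x Q) = CyclotomicLayer.tatePairingPk A κ v n k x Q) →
        ∃ m : ℕ,
          (∀ z : localTowerPointsOfEmb κ (closureEmb (K := ℚ) (v.adicCompletion ℚ)) A →+ ℤ_[2],
            (∀ (t : A.subgroupH1 2 κ.kerSubgroup), t ∈ signedSelmerInfty A κ 1 →
              ∀ (φ : contOneCocycles (discreteTopRep κ.kerSubgroup (A.geomPrimaryTorsion 2)))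
                (Q : localPoints A (v.adicCompletion ℚ)) (k : ℕ), oneCocycleClass _ φ = t →
              ∀ hQ : 2 ^ k • Q ∈ (⨆ n, signedLocalPoints κ (v.adicCompletion ℚ) A 1 n),
              (∀ τ : localSubgroupOfEmb κ.kerSubgroup (closureEmb (K := ℚ) (v.adicCompletion ℚ)),
                pointsMapOfEmb A (closureEmb (K := ℚ) (v.adicCompletion ℚ))
                    ((φ.1 (resGalSubgroupOfEmb κ.kerSubgroup _ τ) : A.geomPrimaryTorsion 2) : A.geomPoints) =
                  (τ : Field.absoluteGaloisGroup (v.adicCompletion ℚ)) • Q - Q) →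
              (PadicInt.toZModPow k
                  (z ⟨2 ^ k • Q, KummerPoint.iSup_signedLocalPoints_le_localTowerPointsOfEmb A 2 κ 1 v hQ⟩)).val •
                ((((2 : ℚ) ^ k)⁻¹ : ℚ) : AddCircle (1 : ℚ)) = 0) →
            ∃ x : I.H, ∀ (n : ℕ) (Q : localPoints A (v.adicCompletion ℚ))
              (hQ : Q ∈ signedLocalPointsOfEmb κ (closureEmb (K := ℚ) (v.adicCompletion ℚ)) A 1 n),
              (2 : ℤ_[2]) ^ m *
                  z ⟨Q, localLayerPointsOfEmb_le_localTowerPointsOfEmb κ _ A n (signedLocalPointsOfEmb_le κ _ A 1 n hQ)⟩ =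
                pair n (I.proj n x) ⟨Q, signedLocalPointsOfEmb_le κ _ A 1 n hQ⟩) :=
  Summit.BirchSwinnertonDyer.BirchSwinnertonDyer.Theorems.SignedLowerOffTwo.PTDeep.poitouTateDeepTwo_of_levelwise_exists
    (Summit.BirchSwinnertonDyer.BirchSwinnertonDyer.Theorems.SignedLowerOffTwo.PTDeep.levelwisePoitouTate_of_transfer
      Summit.BirchSwinnertonDyer.BirchSwinnertonDyer.Theorems.SignedLowerOffTwo.PTDeep.transfer_two)

end Summit.BirchSwinnertonDyer.BirchSwinnertonDyer.Cruxes.SignedMainConjectureCMTwoRankZeroOfPubOfFlat.RankZero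

end
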